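import Summits.ResolutionOfSingularities.ResolutionOfSingularities.Theorems.HilbertSamuelEliminationSigmaMaxModificationsCorridor3Directrix214SharpCentreBase
import Mathlib.RingTheory.Nakayama
import Mathlib.LinearAlgebra.FiniteDimensional.Lemmas
import HarnessLib

/-!
# [OURS · L1 W4.2] `e(C_{X,D,x}) = 1`: the normal directrix is a line — ring-level core of the near-fibre
# clause of 2.14♯ for an ARBITRARY permissible centre (fact-free)

Cell res-hironaka, rung L, slot W4.2 (crux chain w42 `SigmaMaxModifications`, stmt-ResolutionOfSingularities-18506;
conjunct `SigmaMaxModificationsCorridor3`, stmt-ResolutionOfSingularities-19249), stub worker res-L1-w42-stub-3 (gen 4),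
row `stub_Wlow3M_two`: discharge of the (F1♯) near-fibre binder `Moving.Theorem314_nearFibre_geomDir` (stub-4,
`…Corridor3WLadderStrataNearFibreGeomDir`) from printed facts. This file is the NORMAL-CONE twin of the tree's
fact-free `Literature/RingTheory/HilbertSamuel/ProjDirectrixLine.lean` (the case `I = 𝔪`, tangent cone): for a local ring
`(A, 𝔪, k)`, MINIMAL generators `g_0, …, g_n` of an ideal `I` (`μ(I) = n + 1`), the ideal
`J_D = normalConeIdeal g ⊆ k[X_0, …, X_n]` of the normal-cone fibre `C_{X,D,x} ⊂ N_{D,x} = Spec Sym(I/𝔪I)` and its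
directrix space `𝒯 = 𝒯(J_D)`, and a CHART `(φ : A → B, t, u)` of the exceptional divisor at a point `x'` of the blow-up
in `D = V(I)` (`I·B = (t)`, `t` a non-zero-divisor, `φ(g_i) = u_i t`) whose homogeneous prime `𝔭_{x'} = chartPrime φ u`
CONTAINS `𝒯` («`x' ∈ ℙ(Dir(C_{X,D,x}))`», the conclusion of [H4] Th. IV + Hironaka–Mizutani, T7b):

* `exists_linForm_notMem_directrixSpace_normalCone` — if `e(J_D) ≥ 1`, among ANY generators `c_l = Σ_i a_{li} g_i` of `I`
  some symbol `ℓ(a_l) = Σ ā_{li} X_i` lies OFF `𝒯` (minimality of `g`: `mem_maximalIdeal_of_sum_mul_mem_maximalIdeal_mul`);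
* `exists_forall_map_sub_mul_mem_normalCone` — if `e(J_D) = 1` (`𝒯` a hyperplane) and `ℓ(a) ∉ 𝒯` for `t₀ = Σ a_i g_i`:
  constants `α_i ∈ A` (independent of the chart) with `φ(g_i) − φ(α_i) φ(t₀) ∈ (t)·𝔪_B` in every such chart;
* `map_span_eq_span_of_normalCone` — hence **`I·B = (φ t₀)`** (Nakayama);
* `exists_forall_sub_mul_mem_normalCone` — **ratios**: every `y ∈ I` has `β ∈ A` (chart-independent) with
  `φ(y) − φ(β) φ(t₀) ∈ (φ t₀)·𝔪_B` — the point of `ℙ(Dir(C_{X,D,x})) ≅ ℙ⁰_k` is `k`-rational with coordinates read in `A`.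

Everything PROVED, no facts, no `sorry`. [OURS · L1 W4.2] kernel plumbing; NOT a statement of any source and NOT a
statement of H. Hironaka's 2017 manuscript. AI-written; AI review is weaker than expert review.

References: V. Cossart, U. Jannsen, S. Saito, LNM 2270 (2020), Lemma 2.7, Def. 2.8, Thm. 3.2 (2), Thm. 3.14 (proof p. 51
«Proj(A_D) = π_X⁻¹(x)»), p. 103 L32 [CossartJannsenSaito2020]; H. Hironaka, J. Math. Kyoto Univ. 10 (1970) (13.1) p. 168
[Hironaka1970NumericalCharacters]; tree `ProjDirectrixLine.lean`, `ProjDirectrixChart.lean`, `NormalConeFibreIdeal.lean`,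
`…Corridor3Directrix214SharpCentreBase.lean`.
-/

set_option linter.dupNamespace false

noncomputable section

open IsLocalRing MvPolynomial Module
open Literature.AlgebraicGeometry.Resolution Literature.RingTheory.HilbertSamuel Literature.RingTheory.MvPolynomial

namespace Summit.ResolutionOfSingularities.ResolutionOfSingularities.Theorems.SigmaMaxModificationsCorridor3.Directrix214Sharp

universe u v w

/-! ## Linear algebra: a hyperplane and a vector off it -/

section LinearAlgebra

variable {k : Type v} [Field k] {V : Type w} [AddCommGroup V] [Module k V]

/-- A hyperplane and a vector off it span: if `T ≤ S` are subspaces with `dim T + 1 = dim S < ∞` and `ℓ ∈ S ∖ T`, then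
every `m ∈ S` is congruent to a multiple of `ℓ` modulo `T` (copy of the private lemma of `ProjDirectrixLine.lean`).
[folklore; AI-written] -/
theorem exists_sub_smul_mem_of_finrank_succ' {T S : Submodule k V} [FiniteDimensional k S] (hTS : T ≤ S)
    (hrank : finrank k T + 1 = finrank k S) {ℓ : V} (hℓS : ℓ ∈ S) (hℓT : ℓ ∉ T) {m : V} (hm : m ∈ S) :
    ∃ a : k, m - a • ℓ ∈ T := by
  haveI : FiniteDimensional k T := Submodule.finiteDimensional_of_le hTS
  have hℓ0 : ℓ ≠ 0 := fun h => hℓT (h ▸ T.zero_mem)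
  have hinf : T ⊓ (k ∙ ℓ) = ⊥ := by
    refine (Submodule.eq_bot_iff _).mpr fun v hv => ?_
    obtain ⟨hvT, hvℓ⟩ := Submodule.mem_inf.mp hv
    obtain ⟨a, rfl⟩ := Submodule.mem_span_singleton.mp hvℓ
    by_cases ha : a = 0
    · rw [ha, zero_smul]
    · exact absurd (by simpa [smul_smul, inv_mul_cancel₀ ha] using T.smul_mem a⁻¹ hvT) hℓT
  have hsup : T ⊔ (k ∙ ℓ) = S := by
    have hle : T ⊔ (k ∙ ℓ) ≤ S := sup_le hTS ((Submodule.span_singleton_le_iff_mem ℓ S).mpr hℓS)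
    haveI : FiniteDimensional k ↥(T ⊔ (k ∙ ℓ)) := Submodule.finiteDimensional_of_le hle
    refine Submodule.eq_of_le_of_finrank_le hle ?_
    have h := Submodule.finrank_sup_add_finrank_inf_eq T (k ∙ ℓ)
    rw [hinf, finrank_bot, add_zero, finrank_span_singleton hℓ0] at h
    rw [h, hrank]
  rw [← hsup] at hm
  obtain ⟨y, hy, z, hz, rfl⟩ := Submodule.mem_sup.mp hm
  obtain ⟨a, rfl⟩ := Submodule.mem_span_singleton.mp hz
  exact ⟨a, by rwa [add_sub_cancel_right]⟩

end LinearAlgebra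

/-! ## Linear forms -/

section LinearForms

variable {k : Type v} [Field k] {e : ℕ}

/-- The `X_i`-coefficient of `Σ v_j X_j` is `v_i`. [folklore; AI-written] -/
theorem coeff_single_one_linForm' (v : Fin e → k) (i : Fin e) :
    MvPolynomial.coeff (Finsupp.single i 1) (linForm v) = v i := by
  classical
  rw [linForm_apply, MvPolynomial.coeff_sum]
  simp_rw [MvPolynomial.coeff_smul, MvPolynomial.coeff_X, smul_eq_mul]
  rw [Finset.sum_eq_single i]
  · simp
  · intro j _ hj
    rw [if_neg, mul_zero]
    exact fun h => hj (Finsupp.single_left_injective one_ne_zero h)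
  · exact fun h => absurd (Finset.mem_univ i) h

/-- `linForm` is `k`-linear in the coefficient vector (sum form). [folklore; AI-written] -/
theorem linForm_sum_smul' {ι : Type*} (s : Finset ι) (r : ι → k) (v : ι → Fin e → k) :
    linForm (fun i => ∑ l ∈ s, r l * v l i) = ∑ l ∈ s, r l • linForm (v l) := by
  have h : (fun i => ∑ l ∈ s, r l * v l i) = ∑ l ∈ s, r l • v l := by
    funext i
    simp [Finset.sum_apply, Pi.smul_apply, smul_eq_mul]
  rw [h, map_sum]
  exact Finset.sum_congr rfl fun l _ => by rw [map_smul]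

end LinearForms

/-! ## `e(J_D) ≥ 1`: a generator of `I` whose symbol is off the normal directrix -/

section Line

variable {A : Type u} [CommRing A] [IsLocalRing A] {m : ℕ} {g : Fin m → A}
  (hm : (Ideal.span (Set.range g)).spanFinrank = m)

include hm in
/-- **Among any generators `c_1, …, c_r` of `I = (g)`, some symbol lies off the normal directrix** when
`e(J_D) ≥ 1` (`g` MINIMAL generators of `I`, `J_D = normalConeIdeal g`): with expansions `c_l = Σ_i a_{li} g_i`, some
`ℓ(a_l) = Σ_i ā_{li} X_i ∉ 𝒯(J_D)`. Otherwise, writing `g_i = Σ_l b_{il} c_l`, the relation `Σ_j ((ba)_{ij} − δ_{ij}) g_j = 0 ∈ 𝔪I`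
has coefficients in `𝔪` (minimality, `mem_maximalIdeal_of_sum_mul_mem_maximalIdeal_mul`), so `X_i = Σ_l b̄_{il} ℓ(a_l) ∈ 𝒯` for
all `i`, `𝒯 = S_1` and `e(J_D) = 0`. Normal-cone twin of the tree's `exists_linForm_notMem_directrixSpace`.
[OURS · L1 W4.2; folklore; AI-written] -/
theorem exists_linForm_notMem_directrixSpace_normalCone (hd : 0 < directrixDim (normalConeIdeal g))
    {r : ℕ} {c : Fin r → A} (hc : Ideal.span (Set.range c) = Ideal.span (Set.range g))
    (a : Fin r → Fin m → A) (hca : ∀ l, c l = ∑ i, a l i * g i) :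
    ∃ l, linForm (fun i => residue A (a l i)) ∉ directrixSpace (normalConeIdeal g) := by
  classical
  by_contra hall
  simp only [not_exists, not_not] at hall
  set T := directrixSpace (normalConeIdeal g) with hT
  -- `g_i = Σ_l b_{il} c_l`
  have hgi : ∀ i, ∃ b : Fin r → A, ∑ l, b l * c l = g i := fun i =>
    Ideal.mem_span_range_iff_exists_fun.mp (by rw [hc]; exact Ideal.subset_span ⟨i, rfl⟩)
  choose b hb using hgi
  -- every `X_i` lies in `T`
  have hX : ∀ i, (X i : MvPolynomial (Fin m) (ResidueField A)) ∈ T := by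
    intro i
    have hrel : ∑ j, ((∑ l, b i l * a l j) - if j = i then 1 else 0) * g j ∈
        maximalIdeal A * Ideal.span (Set.range g) := by
      have h0 : ∑ j, ((∑ l, b i l * a l j) - if j = i then 1 else 0) * g j = 0 := by
        simp only [sub_mul, Finset.sum_sub_distrib]
        rw [sub_eq_zero]
        have h1 : ∑ j, (∑ l, b i l * a l j) * g j = g i := by
          rw [← hb i]
          simp_rw [Finset.sum_mul, mul_assoc]
          rw [Finset.sum_comm]
          exact Finset.sum_congr rfl fun l _ => by rw [← Finset.mul_sum, ← hca l]
        rw [h1, Finset.sum_eq_single i (fun j _ hj => by rw [if_neg hj, zero_mul])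
          (fun h => absurd (Finset.mem_univ i) h), if_pos rfl, one_mul]
      rw [h0]
      exact zero_mem _
    have hcoef : ∀ j, residue A (∑ l, b i l * a l j) = if j = i then 1 else 0 := by
      intro j
      have h := mem_maximalIdeal_of_sum_mul_mem_maximalIdeal_mul hm hrel j
      rw [← residue_eq_zero_iff, map_sub, sub_eq_zero] at h
      rw [h]
      split_ifs <;> simp
    have hXi : (X i : MvPolynomial (Fin m) (ResidueField A)) =
        ∑ l, residue A (b i l) • linForm (fun j => residue A (a l j)) := by
      rw [← linForm_sum_smul' Finset.univ (fun l => residue A (b i l)) (fun l j => residue A (a l j)),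
        ← linForm_single i]
      congr 1
      funext j
      rw [Pi.single_apply, ← hcoef j, map_sum]
      exact Finset.sum_congr rfl fun l _ => map_mul _ _ _
    rw [hXi]
    exact T.sum_mem fun l _ => T.smul_mem _ (hall l)
  have hS : homogeneousSubmodule (Fin m) (ResidueField A) 1 ≤ T := by
    rw [homogeneousSubmodule_one_eq_span_X, Submodule.span_le]
    rintro _ ⟨i, rfl⟩
    exact hX i
  have hfin := finrank_directrixSpace_add_directrixDim (I := normalConeIdeal g)
  rw [← hT] at hfin
  haveI : FiniteDimensional (ResidueField A) T :=
    Submodule.finiteDimensional_of_le (directrixSpace_le_one (normalConeIdeal g))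
  have hle : finrank (ResidueField A) (homogeneousSubmodule (Fin m) (ResidueField A) 1) ≤
      finrank (ResidueField A) T := Submodule.finrank_mono hS
  rw [finrank_homogeneousSubmodule_one] at hle
  omega

/-! ## `e(J_D) = 1`: the exceptional ideal at a point of `ℙ(Dir(C_{X,D,x}))` is principal -/

variable {B : Type w} [CommRing B] [IsLocalRing B]

omit [IsLocalRing A] [IsLocalRing B] in
/-- **The chart evaluation of a linear combination.** In a chart `φ(g_i) = u_i t`:
`φ(Σ c_i g_i) = (Σ φ(c_i) u_i) · t`. [folklore; AI-written] -/
theorem map_sum_mul_eq_sum_mul_mul (φ : A →+* B) {t : B} {u : Fin m → B} (hut : ∀ i, φ (g i) = u i * t)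
    (c : Fin m → A) : φ (∑ i, c i * g i) = (∑ i, φ (c i) * u i) * t := by
  rw [map_sum, Finset.sum_mul]
  refine Finset.sum_congr rfl fun i _ => ?_
  rw [map_mul, hut i, mul_assoc]

/-- **A linear form in `𝔭_{x'}` is a relation among the `ū_i`.** If `Σ c̄_i X_i ∈ chartPrime φ u` then
`Σ φ(c_i) u_i ∈ 𝔪_B`. [cite: Hironaka1970NumericalCharacters, (13.1) p. 168; AI-written] -/
theorem sum_mul_mem_maximalIdeal_of_linForm_mem_chartPrime (φ : A →+* B) [IsLocalHom φ] (u : Fin m → B)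
    (c : Fin m → A) (h : linForm (fun i => residue A (c i)) ∈ chartPrime φ u) :
    ∑ i, φ (c i) * u i ∈ maximalIdeal B := by
  rw [mem_chartPrime_iff_of_isHomogeneous φ u (isHomogeneous_linForm _), linForm_apply, map_sum] at h
  rw [← residue_eq_zero_iff, map_sum]
  rw [← h]
  refine Finset.sum_congr rfl fun i _ => ?_
  rw [MvPolynomial.smul_eq_C_mul, map_mul (chartEval φ u), chartEval_C, chartEval_X, map_mul,
    ResidueField.map_residue]

/-- **The normal-directrix forms adapted to `t₀`.** If `e(J_D) = 1` and `ℓ(a) ∉ 𝒯(J_D)` for `t₀ = Σ a_i g_i`, then for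
each `i` there is `α_i ∈ A` such that `X_i − ᾱ_i ℓ(a) ∈ 𝒯(J_D)`; consequently in every chart `(φ, t, u)` of the
exceptional divisor (`φ(g_i) = u_i t`) whose prime `𝔭_{x'} = chartPrime φ u` contains `𝒯(J_D)` one has
`φ(g_i) − φ(α_i) φ(t₀) ∈ (t)·𝔪_B`. The `α_i` do not depend on the chart. Normal-cone twin of the tree's
`exists_forall_map_sub_mul_mem`. [OURS · L1 W4.2; folklore; AI-written] -/
theorem exists_forall_map_sub_mul_mem_normalCone (hd : directrixDim (normalConeIdeal g) = 1)
    {t₀ : A} {a : Fin m → A} (hta : t₀ = ∑ i, a i * g i)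
    (hℓ : linForm (fun i => residue A (a i)) ∉ directrixSpace (normalConeIdeal g)) (i : Fin m) :
    ∃ α : A, ∀ (B : Type w) [CommRing B] [IsLocalRing B] (φ : A →+* B) [IsLocalHom φ] (t : B) (u : Fin m → B),
      (∀ i, φ (g i) = u i * t) → (∀ L ∈ directrixSpace (normalConeIdeal g), L ∈ chartPrime φ u) →
        φ (g i) - φ α * φ t₀ ∈ Ideal.span {t} * maximalIdeal B := by
  classical
  set T := directrixSpace (normalConeIdeal g) with hT
  set S := homogeneousSubmodule (Fin m) (ResidueField A) 1 with hS
  haveI : FiniteDimensional (ResidueField A) S := by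
    rw [hS, ← range_linForm]; infer_instance
  have hTS : T ≤ S := directrixSpace_le_one _
  have hrank : finrank (ResidueField A) T + 1 = finrank (ResidueField A) S := by
    rw [hS, finrank_homogeneousSubmodule_one, ← hd]
    exact finrank_directrixSpace_add_directrixDim _
  have hℓS : linForm (fun i => residue A (a i)) ∈ S := by
    rw [hS, ← range_linForm]; exact LinearMap.mem_range_self _ _
  have hXS : (X i : MvPolynomial (Fin m) (ResidueField A)) ∈ S := by rw [hS]; exact isHomogeneous_X _ i
  obtain ⟨abar, habar⟩ := exists_sub_smul_mem_of_finrank_succ' hTS hrank hℓS hℓ hXS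
  obtain ⟨α, rfl⟩ : ∃ α, residue A α = abar := Ideal.Quotient.mk_surjective abar
  refine ⟨α, fun B _ _ φ _ t u hut hTp => ?_⟩
  -- the lift `g_i − α t₀ = Σ_j (δ_{ij} − α a_j) g_j` of the form `X_i − ᾱ ℓ(a)`
  let cf : Fin m → A := fun j => (if j = i then 1 else 0) - α * a j
  have hform : linForm (fun j => residue A (cf j)) =
      (X i : MvPolynomial (Fin m) (ResidueField A)) - residue A α • linForm fun j => residue A (a j) := by
    have h1 : (fun j => residue A (cf j)) =
        Pi.single i (1 : ResidueField A) - residue A α • fun j => residue A (a j) := by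
      funext j
      simp only [cf, map_sub, map_mul, Pi.sub_apply, Pi.smul_apply, Pi.single_apply, smul_eq_mul]
      split_ifs <;> simp
    rw [h1, map_sub, map_smul, linForm_single]
  have hmem : linForm (fun j => residue A (cf j)) ∈ chartPrime φ u := hTp _ (hform ▸ habar)
  have hrelation := sum_mul_mem_maximalIdeal_of_linForm_mem_chartPrime φ u cf hmem
  have hval : ∑ j, cf j * g j = g i - α * t₀ := by
    simp only [cf, sub_mul, Finset.sum_sub_distrib]
    congr 1
    · rw [Finset.sum_eq_single i (fun j _ hj => by rw [if_neg hj, zero_mul])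
        (fun h => absurd (Finset.mem_univ i) h), if_pos rfl, one_mul]
    · rw [hta, Finset.mul_sum]
      exact Finset.sum_congr rfl fun j _ => by ring
  have hφval : φ (g i) - φ α * φ t₀ = (∑ j, φ (cf j) * u j) * t := by
    rw [← map_sum_mul_eq_sum_mul_mul φ hut cf, hval, map_sub, map_mul]
  rw [hφval]
  exact Ideal.mul_mem_mul_rev (Ideal.mem_span_singleton_self t) hrelation

/-- **`I·B = φ(t₀)·B` at a point of `ℙ(Dir(C_{X,D,x}))` when `e(J_D) = 1`** (CJS p. 103 / Thm. 3.14: the exceptional divisor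
at the unique point of `ℙ(Dir_x(X)/T_x(D)) ≅ ℙ⁰` is cut out by one parameter): for a chart `(φ, t, u)` with `I·B = (t)` and
`𝒯(J_D) ⊆ 𝔭_{x'}`, and `t₀ = Σ a_i g_i ∈ I` with symbol `ℓ(a) ∉ 𝒯(J_D)`, the ideal `I·B` is generated by `φ(t₀)`. Proof:
`φ(g_i) ∈ φ(t₀)B + (I·B)𝔪_B` for all `i`, and Nakayama. Normal-cone twin of the tree's
`map_maximalIdeal_eq_span_of_projDirLiftsInto`. [OURS · L1 W4.2; folklore; AI-written] -/
theorem map_span_eq_span_of_normalCone (hd : directrixDim (normalConeIdeal g) = 1)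
    {t₀ : A} {a : Fin m → A} (hta : t₀ = ∑ i, a i * g i)
    (hℓ : linForm (fun i => residue A (a i)) ∉ directrixSpace (normalConeIdeal g))
    (φ : A →+* B) [IsLocalHom φ] {t : B} (hmap : (Ideal.span (Set.range g)).map φ = Ideal.span {t})
    {u : Fin m → B} (hut : ∀ i, φ (g i) = u i * t)
    (hTp : ∀ L ∈ directrixSpace (normalConeIdeal g), L ∈ chartPrime φ u) :
    (Ideal.span (Set.range g)).map φ = Ideal.span {φ t₀} := by
  classical
  have ht₀ : t₀ ∈ Ideal.span (Set.range g) := by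
    rw [hta]
    exact Ideal.sum_mem _ fun i _ => Ideal.mul_mem_left _ _ (Ideal.subset_span ⟨i, rfl⟩)
  apply le_antisymm
  · have hNfg : ((Ideal.span (Set.range g)).map φ).FG := by
      rw [Ideal.map_span]
      exact ⟨(Finset.univ.image (φ ∘ g)), by
        rw [Finset.coe_image, Finset.coe_univ, Set.image_univ, Set.range_comp]⟩
    have hle : (Ideal.span (Set.range g)).map φ ≤
        Ideal.span {φ t₀} ⊔ maximalIdeal B • (Ideal.span (Set.range g)).map φ := by
      conv_lhs => rw [Ideal.map_span]
      rw [Ideal.span_le]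
      rintro _ ⟨_, ⟨i, rfl⟩, rfl⟩
      obtain ⟨α, hα⟩ := exists_forall_map_sub_mul_mem_normalCone hd hta hℓ i
      have hmem := hα B φ t u hut hTp
      have : φ (g i) = φ α * φ t₀ + (φ (g i) - φ α * φ t₀) := by ring
      rw [this]
      refine Submodule.add_mem_sup (Ideal.mul_mem_left _ _ (Ideal.mem_span_singleton_self _)) ?_
      rw [Ideal.smul_eq_mul, mul_comm (maximalIdeal B), hmap]
      exact hmem
    exact Submodule.le_of_le_smul_of_le_jacobson_bot hNfg (IsLocalRing.maximalIdeal_le_jacobson ⊥) hle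
  · rw [Ideal.span_le, Set.singleton_subset_iff]
    exact Ideal.mem_map_of_mem φ ht₀

/-- **Ratios `y/t₀` at a point of `ℙ(Dir(C_{X,D,x}))`, `e(J_D) = 1`.** For every `y ∈ I` there is `β ∈ A` — depending on
`y` only — such that in every chart `(φ, t, u)` with `I·B = (t)` and `𝒯(J_D) ⊆ 𝔭_{x'}`: `φ(y) − φ(β)φ(t₀) ∈ φ(t₀)·𝔪_B`
(`t₀`, `ℓ(a) ∉ 𝒯` as above; `β = Σ y_i α_i` for `y = Σ y_i g_i`). In the blow-up chart: the regular function `y/t₀` takes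
the value `β̄ ∈ k` at the point — the point of `ℙ(Dir(C_{X,D,x})) ≅ ℙ⁰_k` is `k`-rational with coordinates computed in `A`.
Normal-cone twin of the tree's `exists_forall_sub_mul_mem_of_projDirLiftsInto`. [OURS · L1 W4.2; folklore; AI-written] -/
theorem exists_forall_sub_mul_mem_normalCone (hd : directrixDim (normalConeIdeal g) = 1)
    {t₀ : A} {a : Fin m → A} (hta : t₀ = ∑ i, a i * g i)
    (hℓ : linForm (fun i => residue A (a i)) ∉ directrixSpace (normalConeIdeal g))
    {y : A} (hy : y ∈ Ideal.span (Set.range g)) :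
    ∃ β : A, ∀ (B : Type w) [CommRing B] [IsLocalRing B] (φ : A →+* B) [IsLocalHom φ] (t : B) (u : Fin m → B),
      (Ideal.span (Set.range g)).map φ = Ideal.span {t} → (∀ i, φ (g i) = u i * t) →
      (∀ L ∈ directrixSpace (normalConeIdeal g), L ∈ chartPrime φ u) →
        φ y - φ β * φ t₀ ∈ Ideal.span {φ t₀} * maximalIdeal B := by
  classical
  obtain ⟨yc, hyc⟩ : ∃ yc : Fin m → A, ∑ i, yc i * g i = y := Ideal.mem_span_range_iff_exists_fun.mp hy
  have hαi := fun i => exists_forall_map_sub_mul_mem_normalCone.{u, w} hd hta hℓ i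
  choose α hα using hαi
  refine ⟨∑ i, yc i * α i, fun B _ _ φ _ t u hmap hut hTp => ?_⟩
  have hspan := map_span_eq_span_of_normalCone hd hta hℓ φ hmap hut hTp
  have hdec : φ y - φ (∑ i, yc i * α i) * φ t₀ = ∑ i, φ (yc i) * (φ (g i) - φ (α i) * φ t₀) := by
    rw [← hyc, map_sum, map_sum, Finset.sum_mul]
    simp only [map_mul, mul_sub, Finset.sum_sub_distrib]
    congr 1
    exact Finset.sum_congr rfl fun i _ => by ring
  rw [hdec]
  refine Ideal.sum_mem _ fun i _ => Ideal.mul_mem_left _ _ ?_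
  have h := hα i B φ t u hut hTp
  rwa [← hmap, hspan] at h

end Line

end Summit.ResolutionOfSingularities.ResolutionOfSingularities.Theorems.SigmaMaxModificationsCorridor3.Directrix214Sharp

end
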